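import Literature.MathematicalPhysics.QuantumFieldTheory.Balaban1983to89.Node00.LocalizedSum17
import Literature.MathematicalPhysics.QuantumFieldTheory.Balaban1983to89.Node00.Record13Chi

/-!
# NODE 00 ∕ W1 — THE (1.7) LAW AT THE RECORD RE-ISSUED GENERIC IN THE β-SLOT χ («Chi») WITH THE RE-CENTRED («Ax») INSTANCE: `Localizes17OfRecord₁₃Chi θ χ S emb`
# (W1-20's `Localizes17OfRecord₁₃` with the merged term family read at the cut-off `χ`), its `Iff.rfl` face, the receipt at `χ := chiβOfRecord₁₃ θ`, and `Localizes17OfRecord₁₃Ax`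

Cell `pub-ymgap` (YM-PLAN Track A, D-0062), width seat `pub-ymgap-dag-n07-w3` (g23).  WORK ORDER RC-1 (director-ym №462∕№467 (D)); companion of this seat's ✓p811021
`Node00/U3KernelLettersChi` (whose reading-side faces `…_iff_of_localizes` were LOCATED as needing this law's χ edition).  NEW sibling module — nothing of W1-20's
`Node00/LocalizedSum17` (node00-def-W1 g29) is edited; pattern of dag-n16-e's ✓p802930 `Node00/U3OfKernelsChi` ([Ax-3b]∕[Ax-3c]).  STATEMENT-ONLY: definitions (binders) +
`Iff.rfl` faces; the TRANSFER theorems (objects ∕ predicates ∕ letters of record ⟺ the same at the W1 reading's localized sum, under the law) live Summits-side in the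
companion `Summits/QuantumFields/YangMills/Theorems/BalabanUVNodesU3LettersAtReadingChi.lean` (proof lane).  0 `sorry` ∕ `instance` ∕ `notation`; nothing re-declared
(`Localizes17`, `localizedSum`, `ReadingMaps`, `objectsOfReading₁₃` are W1-20's, cited by name — `objectsOfReading₁₃` is χ-FREE: it reads the reading's towers in θ's chart only).
[I] = [Balaban1987RG1]; [RG2] = [Balaban1988RG2Cluster].

WHY.  W1-20's law at the record `Localizes17OfRecord₁₃ θ S emb` says the merged term family AT THE CHOICE-CENTRED cut-off `chiβOfRecord₁₃ θ` IS the localized sum of the reading's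
towers; the re-centred K-Ax items (K0ᴬ 27238 ∕ K1ᴬ 27239 ∕ K3ᴬ 27247) read `betaOfRecord₁₃Ax θ`, i.e. the kernels of `mergedTermFamilyMatT … (chiβOfRecord₁₃Ax θ) …`; every READING-SIDE
face (U3KernelLetters §2 `…_iff_of_localizes`, `LocalizedSum17.iff_of_localizes17OfRecord₁₃`, N22∕N18's `n22At_…_objects_iff`) that is to be re-keyed to the Ax record needs the law keyed to the
SAME cut-off.  This file supplies the name.

HONEST LIMITS.  A displayed LAW (hypothesis shape) re-issued over a parameter + `Iff.rfl` faces; its inhabitant — the cluster expansion of the RG-defined actions, [RG2] Lemmas 1–3 with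
[I] §1 — is nobody's theorem today; nothing of Bałaban asserted; count-neutral; K0ᴬ ∕ K1ᴬ ∕ K3ᴬ OPEN; one finite-torus programme at fixed lattice spacing — nothing continuum, nothing OS;
the Yang–Mills mass gap (Clay) is NOT proved by any of this.

## CITATION HEADER (D-0065)
- [I] = T. Bałaban, Renormalization group approach to lattice gauge field theories. I., Comm. Math. Phys. 109 (1987) 249–301 [Balaban1987RG1]: (1.6)–(1.7) p. 261, (2.9) p. 266.
- [RG2] = T. Bałaban, Renormalization group approach to lattice gauge field theories. II. Cluster expansions, Comm. Math. Phys. 116 (1988) 1–22 [Balaban1988RG2Cluster]: (2.13)–(2.14) pp. 14–15.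

Typer lint: no `instance`, no `notation`, no attribute removal, no `sorry`; imports `Node00.LocalizedSum17` and `Node00.Record13Chi` (`ChiSlot`, `chiβOfRecord₁₃Ax`) only.
-/

namespace Literature.MathematicalPhysics.QuantumFieldTheory.Balaban1983to89.Node00.LocalizedSum17

open T4Continuum (T4Family)
open W1 (ClusterTower)

section RecordChi

open scoped Matrix.Norms.L2Operator

variable (F : T4Family) (N : ℕ) [NeZero N] {𝔸 : Type*} {M : ℕ}

/-- **THE (1.7) LAW AT THE RECORD, β-slot χ**: the merged term family read at the cut-off `χ`, `mergedTermFamilyMatT F N (TβOfRecord₁₃ F N) χ θ.εbg`, IS the localized sum of the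
reading's towers `S` through `emb` (W1-20's `Localizes17OfRecord₁₃` with `chiβOfRecord₁₃ F N θ ↦ χ`).  DISPLAYED HYPOTHESIS. [cite: Balaban1987RG1, (1.7) p.261, (2.9) p.266; Balaban1988RG2Cluster, (2.14) p.15] -/
def Localizes17OfRecord₁₃Chi (θ : Stage13Params F N) (χ : ChiSlot F N) (S : (K : ℕ) → ClusterTower (F.P K) 𝔸 M) (emb : ReadingMaps F (MatA N) 𝔸) : Prop :=
  Localizes17 F S emb (mergedTermFamilyMatT F N (TβOfRecord₁₃ F N) χ θ.εbg)

/-- Face (`Iff.rfl`). [cite: Balaban1987RG1, (1.7) p.261 (bookkeeping)] -/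
theorem localizes17OfRecord₁₃Chi_iff (θ : Stage13Params F N) (χ : ChiSlot F N) (S : (K : ℕ) → ClusterTower (F.P K) 𝔸 M) (emb : ReadingMaps F (MatA N) 𝔸) :
    Localizes17OfRecord₁₃Chi F N θ χ S emb ↔ Localizes17 F S emb (mergedTermFamilyMatT F N (TβOfRecord₁₃ F N) χ θ.εbg) := Iff.rfl

/-- Receipt: at the record's β-slot the χ-law IS W1-20's law of record (`Iff.rfl`). [cite: Balaban1987RG1, (1.7) p.261 (bookkeeping)] -/
theorem localizes17OfRecord₁₃Chi_chiβ_iff (θ : Stage13Params F N) (S : (K : ℕ) → ClusterTower (F.P K) 𝔸 M) (emb : ReadingMaps F (MatA N) 𝔸) :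
    Localizes17OfRecord₁₃Chi F N θ (chiβOfRecord₁₃ F N θ) S emb ↔ Localizes17OfRecord₁₃ F N θ S emb := Iff.rfl

/-- **THE (1.7) LAW AT THE RE-CENTRED RECORD** (`χ := chiβOfRecord₁₃Ax θ`).  DISPLAYED HYPOTHESIS. [cite: Balaban1987RG1, (1.7) p.261, (2.9) p.266; Balaban1988RG2Cluster, (2.14) p.15] -/
abbrev Localizes17OfRecord₁₃Ax (θ : Stage13Params F N) (S : (K : ℕ) → ClusterTower (F.P K) 𝔸 M) (emb : ReadingMaps F (MatA N) 𝔸) : Prop :=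
  Localizes17OfRecord₁₃Chi F N θ (chiβOfRecord₁₃Ax F N θ) S emb

/-- Face (`Iff.rfl`): the re-centred law IS the GENERIC `Localizes17` at the re-centred merged term family. [cite: Balaban1987RG1, (1.7) p.261 (bookkeeping)] -/
theorem localizes17OfRecord₁₃Ax_iff (θ : Stage13Params F N) (S : (K : ℕ) → ClusterTower (F.P K) 𝔸 M) (emb : ReadingMaps F (MatA N) 𝔸) :
    Localizes17OfRecord₁₃Ax F N θ S emb ↔ Localizes17 F S emb (mergedTermFamilyMatT F N (TβOfRecord₁₃ F N) (chiβOfRecord₁₃Ax F N θ) θ.εbg) := Iff.rfl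

end RecordChi

end Literature.MathematicalPhysics.QuantumFieldTheory.Balaban1983to89.Node00.LocalizedSum17
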